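import Mathlib
import Summits.Ventures.YMGap.FlowData.EigenRadiusFloatBasis

/-!
# Venture YMGap, track Y3 FLOW-DATA — when the program's radius of record COVERS the typed Kahan radius

HONEST FRAMING: venture file of the cell `pub-ymgap` (QuantumFields programme), track Y3, lineage B
("B-kstm"), companion of `FlowData/EigenRadiusCertificate.lean` (p368467), `EigenRadiusInvariantBlock.lean`
(p368753) and `EigenRadiusFloatBasis.lean` (p370011).  Those files conclude an index-wise radius of KAHAN
form, `(E1 + √(1+ε)·E0′) / √(1−ε)`; the rows of record quote the PROGRAM's radius
`δ = (E1 + E0·√(1+ε)) + ε·(nS + Lmax)` (`kscert.c` / `certeig.c`, `certify_block`), plus, for space-group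
blocks, two additive terms.  `abs_eigenvalues₀_sub_le_recordRadius` compares the two under the side
condition `ε ≤ 1/2 ∧ E1 + E0√(1+ε) ≤ nS + Lmax`, which needs the STORED residuals `E1, E0, ε`; for the
space-group blocks of the certificates only `δ` is stored.  This file types two comparison routes whose
hypotheses are checkable from the stored fields alone (pure real arithmetic, then the matrix corollaries):

* ROUTE A′ `div_sqrt_le_record_of_le_three_quarters`: if `δ ≤ (3/4)·Lmax` (`a := E1 + E0√(1+ε) ≥ 0`,
  `nS ≥ 0`, `Lmax > 0`, `ε ≥ 0`) then `ε ≤ 3/4` and `(a + √(1+ε)·G)/√(1−ε) ≤ δ + 3·G` for every `G ≥ 0`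
  (`ε·Lmax ≤ δ`; with `s = √(1−ε) ≥ 1/2`: `a(1−s) ≤ (3/4)Lmax(1−s) ≤ s(1+s)(1−s)Lmax = s·ε·Lmax`);
* ROUTE B `div_sqrt_le_record_of_drop`: if `0 < D ≤ a`, `D ≤ nS`, `Lmax ≥ 0`, `ε ≥ 0` and `δ ≤ (5/4)·D`
  then `ε ≤ 1/4` and `(a + √(1+ε)·G)/√(1−ε) ≤ δ + (13/10)·G` (`ε·D ≤ δ − a ≤ D/4`; `s ≥ 3/4`, `s(1+s) ≥ 5/4`).
  In the program `D` = the pruning perturbation `‖dS‖_F` ("drop_fro_bound"), folded into EVERY block's `E0`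
  (`certify_block`: `E0 = γ√ΣS² + √ΣSerr² + dropF`, `nS = ‖A‖_F + E0`), so `D ≤ E0 ≤ a` and `D ≤ nS`;
* `abs_eigenvalues₀_sub_le_recordRadius_of_le_three_quarters` / `_of_drop` — the program's `δ` is an
  index-wise radius for the exact block under route A′ / route B (NO hypothesis `ε < 1`: it is derived);
* `exists_orthonormal_eigenvectors_of_invariantBlock_float_record_of_le_three_quarters` / `_of_drop` — the
  space-group form: for an EXACTLY orthonormal symmetry basis `Y` (`Yᴴ Y = 1`, range `S`-invariant) and the
  program's float-basis residuals (`EigenRadiusFloatBasis`), the orthonormal eigenvectors of `S` in the range of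
  `Y` have sorted eigenvalues within `δ_H + c·(2Λ₁η + Λη²)` of sorted `L` (`c = 3`, resp. `13/10`) — so the
  radius of record `δ_H + ostrowski + subspace` encloses whenever `c·(2Λ₁η + Λη²) ≤ ostrowski + subspace`.

DATA (cell file `flow/flow-eng-2/RADIUS-CHECK.md`, v2 by flow-eng-2 g5, exact rational screen of the stored
decimal fields of all 56 lineage-B certificates): 256/256 `certify_block` records satisfy the side condition
of `abs_eigenvalues₀_sub_le_recordRadius`; of the 345 space-group blocks 342 satisfy route A′ (132 of them
also route B) and 3 satisfy route B only (the `A2` blocks at `3×3`, `4×4`, `β = 3/4` and one 7-dimensional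
flux-2 block at `4×4`, `β = 1/4`, whose top eigenvalue lies below the pruning radius); slack factors ≥ 32.
No lattice object, no number of record, nothing about limits or a mass gap is asserted here; the program's
interval arithmetic producing `E0, E1, ε, η` is NOT modelled (hypotheses, as in the companion files).

References: G. W. Stewart, J.-G. Sun, *Matrix Perturbation Theory* (1990), Thm IV.5.4 / VI.1.15
[cite: StewartSun1990, Thm IV.5.4]; W. Kahan, Proc. AMS 48 (1975) 11–17 [cite: Kahan1975]; the cell's
`pub-ymgap-flow-eng-2/kscert.c` (`certify_block`, symmetry blocks) and `flow/flow-eng-2/RADIUS-CHECK.md`.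
-/

noncomputable section

open Matrix WithLp
open scoped InnerProductSpace

namespace Summit.Ventures.YMGap.FlowData

namespace EigenRadius

/-! ### The two arithmetic routes -/

/-- **Route A′ (top-dominated blocks).** If `a, nS, ε ≥ 0`, `Lmax > 0`, `G ≥ 0` and the program's radius
`δ = a + ε·(nS + Lmax)` satisfies `δ ≤ (3/4)·Lmax`, then `ε ≤ 3/4` and the Kahan-form radius with an extra
glue term is covered: `(a + √(1+ε)·G) / √(1−ε) ≤ δ + 3·G`. [folklore] -/
theorem div_sqrt_le_record_of_le_three_quarters {a nS Lmax ε G : ℝ} (ha : 0 ≤ a) (hnS : 0 ≤ nS)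
    (hLmax : 0 < Lmax) (hε0 : 0 ≤ ε) (hG : 0 ≤ G)
    (hroute : a + ε * (nS + Lmax) ≤ 3 / 4 * Lmax) :
    ε ≤ 3 / 4 ∧ (a + √(1 + ε) * G) / √(1 - ε) ≤ (a + ε * (nS + Lmax)) + 3 * G := by
  have hεnS : 0 ≤ ε * nS := mul_nonneg hε0 hnS
  have hεL : ε * Lmax ≤ 3 / 4 * Lmax := by nlinarith
  have hε : ε ≤ 3 / 4 := by
    by_contra h
    have := mul_lt_mul_of_pos_right (not_le.mp h) hLmax
    linarith
  refine ⟨hε, ?_⟩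
  have h1ε : 0 < 1 - ε := by linarith
  set s := √(1 - ε) with hs_def
  have hs : 0 < s := Real.sqrt_pos.2 h1ε
  have hs2 : s ^ 2 = 1 - ε := Real.sq_sqrt h1ε.le
  have hs1 : s ≤ 1 := by nlinarith
  have hshalf : 1 / 2 ≤ s := by nlinarith
  have haL : a ≤ 3 / 4 * Lmax := by nlinarith
  -- `a ≤ δ·s`: a(1−s) ≤ (3/4)Lmax(1−s) ≤ s(1+s)Lmax(1−s) = s·ε·Lmax ≤ s·ε·(nS + Lmax)
  have hkey : a ≤ (a + ε * (nS + Lmax)) * s := by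
    have h1s : 0 ≤ 1 - s := by linarith
    have h1 : a * (1 - s) ≤ 3 / 4 * Lmax * (1 - s) := mul_le_mul_of_nonneg_right haL h1s
    have h34 : 3 / 4 ≤ s * (1 + s) := by nlinarith
    have h2 : 3 / 4 * Lmax * (1 - s) ≤ s * (1 + s) * Lmax * (1 - s) := by
      have := mul_le_mul_of_nonneg_right h34 (mul_nonneg hLmax.le h1s)
      nlinarith
    have h3 : s * (1 + s) * Lmax * (1 - s) = s * (ε * Lmax) := by
      have e : (1 + s) * (1 - s) = ε := by nlinarith
      calc s * (1 + s) * Lmax * (1 - s) = s * (((1 + s) * (1 - s)) * Lmax) := by ring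
        _ = s * (ε * Lmax) := by rw [e]
    have h4 : s * (ε * Lmax) ≤ s * (ε * (nS + Lmax)) :=
      mul_le_mul_of_nonneg_left (by nlinarith) hs.le
    nlinarith
  -- glue factor: `√(1+ε) ≤ 3·s` since `1 + ε ≤ 9(1 − ε)` for `ε ≤ 4/5`
  have hglue : √(1 + ε) ≤ 3 * s := by
    have h9 : 1 + ε ≤ (3 * s) ^ 2 := by nlinarith
    calc √(1 + ε) ≤ √((3 * s) ^ 2) := Real.sqrt_le_sqrt h9
      _ = 3 * s := Real.sqrt_sq (by linarith)
  rw [div_le_iff₀ hs]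
  have h5 : √(1 + ε) * G ≤ 3 * G * s := by nlinarith [mul_le_mul_of_nonneg_right hglue hG]
  have e : ((a + ε * (nS + Lmax)) + 3 * G) * s = (a + ε * (nS + Lmax)) * s + 3 * G * s := by ring
  rw [e]
  linarith

/-- **Route B (pruning-dominated blocks).** If `0 < D ≤ a`, `D ≤ nS`, `Lmax ≥ 0`, `ε ≥ 0`, `G ≥ 0` and
the program's radius `δ = a + ε·(nS + Lmax)` satisfies `δ ≤ (5/4)·D`, then `ε ≤ 1/4` and
`(a + √(1+ε)·G) / √(1−ε) ≤ δ + (13/10)·G`.  (In `kscert.c` the pruning perturbation `D = ‖dS‖_F` is part of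
every block's `E0`, whence `D ≤ E0 ≤ a` and `D ≤ nS = ‖A‖_F + E0`.) [folklore] -/
theorem div_sqrt_le_record_of_drop {a D nS Lmax ε G : ℝ} (hD : 0 < D) (hDa : D ≤ a) (hDnS : D ≤ nS)
    (hLmax : 0 ≤ Lmax) (hε0 : 0 ≤ ε) (hG : 0 ≤ G)
    (hroute : a + ε * (nS + Lmax) ≤ 5 / 4 * D) :
    ε ≤ 1 / 4 ∧ (a + √(1 + ε) * G) / √(1 - ε) ≤ (a + ε * (nS + Lmax)) + 13 / 10 * G := by
  have hεD : ε * D ≤ ε * (nS + Lmax) := mul_le_mul_of_nonneg_left (by linarith) hε0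
  have hεD' : ε * D ≤ 1 / 4 * D := by linarith
  have hε : ε ≤ 1 / 4 := by
    by_contra h
    have := mul_lt_mul_of_pos_right (not_le.mp h) hD
    linarith
  refine ⟨hε, ?_⟩
  have h1ε : 0 < 1 - ε := by linarith
  set s := √(1 - ε) with hs_def
  have hs : 0 < s := Real.sqrt_pos.2 h1ε
  have hs2 : s ^ 2 = 1 - ε := Real.sq_sqrt h1ε.le
  have hs1 : s ≤ 1 := by nlinarith
  have hs34 : 3 / 4 ≤ s := by nlinarith
  have haD : a ≤ 5 / 4 * D := by nlinarith
  -- `a ≤ δ·s`: a(1−s) ≤ (5/4)D(1−s) ≤ s(1+s)D(1−s) = s·ε·D ≤ s·ε·(nS + Lmax)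
  have hkey : a ≤ (a + ε * (nS + Lmax)) * s := by
    have h1s : 0 ≤ 1 - s := by linarith
    have h1 : a * (1 - s) ≤ 5 / 4 * D * (1 - s) := mul_le_mul_of_nonneg_right haD h1s
    have h54 : 5 / 4 ≤ s * (1 + s) := by nlinarith
    have h2 : 5 / 4 * D * (1 - s) ≤ s * (1 + s) * D * (1 - s) := by
      have := mul_le_mul_of_nonneg_right h54 (mul_nonneg hD.le h1s)
      nlinarith
    have h3 : s * (1 + s) * D * (1 - s) = s * (ε * D) := by
      have e : (1 + s) * (1 - s) = ε := by nlinarith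
      calc s * (1 + s) * D * (1 - s) = s * (((1 + s) * (1 - s)) * D) := by ring
        _ = s * (ε * D) := by rw [e]
    have h4 : s * (ε * D) ≤ s * (ε * (nS + Lmax)) := mul_le_mul_of_nonneg_left hεD hs.le
    nlinarith
  -- glue factor: `√(1+ε) ≤ (13/10)·s` since `100(1 + ε) ≤ 169(1 − ε)` for `ε ≤ 69/269`
  have hglue : √(1 + ε) ≤ 13 / 10 * s := by
    have h9 : 1 + ε ≤ (13 / 10 * s) ^ 2 := by nlinarith
    calc √(1 + ε) ≤ √((13 / 10 * s) ^ 2) := Real.sqrt_le_sqrt h9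
      _ = 13 / 10 * s := Real.sqrt_sq (by linarith)
  rw [div_le_iff₀ hs]
  have h5 : √(1 + ε) * G ≤ 13 / 10 * G * s := by nlinarith [mul_le_mul_of_nonneg_right hglue hG]
  have e : ((a + ε * (nS + Lmax)) + 13 / 10 * G) * s = (a + ε * (nS + Lmax)) * s + 13 / 10 * G * s := by
    ring
  rw [e]
  linarith

/-! ### Block certificates: the radius of record without the stored-residual side condition -/

variable {𝕜 : Type*} [RCLike 𝕜] {m : Type*} [Fintype m] [DecidableEq m]

/-- **Radius of record, route A′.** Hypotheses of `abs_eigenvalues₀_sub_le_kahanRadius` except `ε < 1`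
(`S` Hermitian = exact block, `A`, `X` arbitrary, `L` real; `Σ‖(S − A)ᵢⱼ‖² ≤ E0²`,
`Σ‖(A X − X·diag L)ᵢⱼ‖² ≤ E1²`, `Σ‖(Xᴴ X − 1)ᵢⱼ‖² ≤ ε²`, `E0, E1, ε ≥ 0`), together with `nS ≥ 0`, `Lmax > 0`
and `δ := (E1 + E0·√(1+ε)) + ε·(nS + Lmax) ≤ (3/4)·Lmax`.  Then `|λ↓ᵢ(S) − λ↓ᵢ(diag L)| ≤ δ` for every `i`.
(In the program `Lmax = max|L| ≥` the top entry of `eig_desc`, so the route holds as soon as the stored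
`δ` is at most three quarters of the block's top computed eigenvalue.) [cite: StewartSun1990, Thm IV.5.4] -/
theorem abs_eigenvalues₀_sub_le_recordRadius_of_le_three_quarters {S A X : Matrix m m 𝕜}
    (hS : S.IsHermitian) (L : m → ℝ) {E0 E1 ε nS Lmax : ℝ} (hE0 : 0 ≤ E0) (hE1 : 0 ≤ E1) (hε0 : 0 ≤ ε)
    (hnS : 0 ≤ nS) (hLmax : 0 < Lmax)
    (h0 : ∑ i, ∑ j, ‖(S - A) i j‖ ^ 2 ≤ E0 ^ 2)
    (h1 : ∑ i, ∑ j, ‖(A * X - X * diagonal (fun j => ((L j : ℝ) : 𝕜))) i j‖ ^ 2 ≤ E1 ^ 2)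
    (hG : ∑ i, ∑ j, ‖(Xᴴ * X - 1) i j‖ ^ 2 ≤ ε ^ 2)
    (hroute : (E1 + E0 * √(1 + ε)) + ε * (nS + Lmax) ≤ 3 / 4 * Lmax) (i : Fin (Fintype.card m)) :
    |hS.eigenvalues₀ i - (isHermitian_diagonal_ofReal (𝕜 := 𝕜) L).eigenvalues₀ i| ≤
      (E1 + E0 * √(1 + ε)) + ε * (nS + Lmax) := by
  have ha : 0 ≤ E1 + E0 * √(1 + ε) := by positivity
  obtain ⟨hε, h⟩ := div_sqrt_le_record_of_le_three_quarters ha hnS hLmax hε0 (le_refl (0 : ℝ)) hroute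
  have hK := abs_eigenvalues₀_sub_le_kahanRadius hS L hE0 hE1 hε0 (by linarith) h0 h1 hG i
  simp only [mul_zero, add_zero] at h
  exact hK.trans h

/-- **Radius of record, route B.** Hypotheses of `abs_eigenvalues₀_sub_le_kahanRadius` except `ε < 1`,
together with a positive part `D` of `E0` that is also below `nS` (`0 < D ≤ E0 ≤ nS`; in the program `D` =
the pruning perturbation `drop_fro_bound` and `nS = ‖A‖_F + E0`), `Lmax ≥ 0`, and
`δ := (E1 + E0·√(1+ε)) + ε·(nS + Lmax) ≤ (5/4)·D`.  Then `|λ↓ᵢ(S) − λ↓ᵢ(diag L)| ≤ δ` for every `i` — the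
case of blocks whose whole spectrum lies below the pruning radius. [cite: StewartSun1990, Thm IV.5.4] -/
theorem abs_eigenvalues₀_sub_le_recordRadius_of_drop {S A X : Matrix m m 𝕜}
    (hS : S.IsHermitian) (L : m → ℝ) {E0 E1 ε nS Lmax D : ℝ} (hE1 : 0 ≤ E1) (hε0 : 0 ≤ ε)
    (hD : 0 < D) (hDE0 : D ≤ E0) (hE0nS : E0 ≤ nS) (hLmax : 0 ≤ Lmax)
    (h0 : ∑ i, ∑ j, ‖(S - A) i j‖ ^ 2 ≤ E0 ^ 2)
    (h1 : ∑ i, ∑ j, ‖(A * X - X * diagonal (fun j => ((L j : ℝ) : 𝕜))) i j‖ ^ 2 ≤ E1 ^ 2)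
    (hG : ∑ i, ∑ j, ‖(Xᴴ * X - 1) i j‖ ^ 2 ≤ ε ^ 2)
    (hroute : (E1 + E0 * √(1 + ε)) + ε * (nS + Lmax) ≤ 5 / 4 * D) (i : Fin (Fintype.card m)) :
    |hS.eigenvalues₀ i - (isHermitian_diagonal_ofReal (𝕜 := 𝕜) L).eigenvalues₀ i| ≤
      (E1 + E0 * √(1 + ε)) + ε * (nS + Lmax) := by
  have hE0 : 0 ≤ E0 := hD.le.trans hDE0
  have h1le : (1 : ℝ) ≤ √(1 + ε) := Real.one_le_sqrt.2 (by linarith)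
  have hDa : D ≤ E1 + E0 * √(1 + ε) := by nlinarith [mul_le_mul_of_nonneg_left h1le hE0]
  obtain ⟨hε, h⟩ :=
    div_sqrt_le_record_of_drop hD hDa (hDE0.trans hE0nS) hLmax hε0 (le_refl (0 : ℝ)) hroute
  have hK := abs_eigenvalues₀_sub_le_kahanRadius hS L hE0 hE1 hε0 (by linarith) h0 h1 hG i
  simp only [mul_zero, add_zero] at h
  exact hK.trans h

/-! ### Space-group blocks: the radius of record for an exactly orthonormal symmetry basis -/

variable {N : Type*} [Fintype N] [DecidableEq N]

omit [DecidableEq N] in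
/-- An exactly orthonormal basis has zero Gram defect (feeder for `ε_G = 0`). [folklore] -/
theorem sum_norm_sq_gram_sub_one_of_orthonormal (Y : Matrix N m 𝕜) (hYY : Yᴴ * Y = 1) :
    ∑ i, ∑ j, ‖(Yᴴ * Y - 1 : Matrix m m 𝕜) i j‖ ^ 2 ≤ (0 : ℝ) ^ 2 := by
  simp [hYY]

/-- **Space-group radius of record, route A′.** Let `S` be Hermitian, `Y` an EXACTLY orthonormal basis
(`Yᴴ Y = 1`) of an `S`-invariant subspace (`S Y = Y C`), `Ỹ` the float basis actually held
(`Σ‖(Ỹ − Y)ᵢⱼ‖² ≤ η²`), `‖S v‖ ≤ Λ‖v‖`, `‖(S Y) v‖ ≤ Λ₁‖v‖`, and let the program's residuals for the float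
block hold: `Σ‖(Ỹᴴ S Ỹ − A)ᵢⱼ‖² ≤ E0²`, `Σ‖(A X − X·diag L)ᵢⱼ‖² ≤ E1²`, `Σ‖(Xᴴ X − 1)ᵢⱼ‖² ≤ ε²`, `|L j| ≤ Lmax`,
with `nS ≥ 0`, `Lmax > 0` and `δ_H := (E1 + E0√(1+ε)) + ε(nS + Lmax) ≤ (3/4)·Lmax`.  Then there are
orthonormal eigenvectors `wᵢ` of `S` spanning directions in the range of `Y`, eigenvalues `λ₀ ≥ ⋯`, with
`|λᵢ − λ↓ᵢ(diag L)| ≤ δ_H + 3·(2Λ₁η + Λη²)` — hence within the radius of record `δ_H + ostrowski + subspace`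
whenever `3·(2Λ₁η + Λη²) ≤ ostrowski + subspace`. [cite: StewartSun1990, Thm VI.1.15] -/
theorem exists_orthonormal_eigenvectors_of_invariantBlock_float_record_of_le_three_quarters
    {S : Matrix N N 𝕜} (hS : S.IsHermitian) (Y Yt : Matrix N m 𝕜) {C : Matrix m m 𝕜}
    (hSY : S * Y = Y * C) (hYY : Yᴴ * Y = 1) (A X : Matrix m m 𝕜) (L : m → ℝ)
    {E0 E1 ε nS Lmax η Λ Λ₁ : ℝ} (hE0 : 0 ≤ E0) (hE1 : 0 ≤ E1) (hε0 : 0 ≤ ε) (hnS : 0 ≤ nS)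
    (hLmax : 0 < Lmax) (hL : ∀ j, |L j| ≤ Lmax) (hη : 0 ≤ η) (hΛ : 0 ≤ Λ) (hΛ₁ : 0 ≤ Λ₁)
    (hroute : (E1 + E0 * √(1 + ε)) + ε * (nS + Lmax) ≤ 3 / 4 * Lmax)
    (hE : ∑ i, ∑ j, ‖(Yt - Y) i j‖ ^ 2 ≤ η ^ 2)
    (hSop : ∀ v : EuclideanSpace 𝕜 N, ‖toEuclideanLin S v‖ ≤ Λ * ‖v‖)
    (hSYop : ∀ v : EuclideanSpace 𝕜 m, ‖toEuclideanLin (S * Y) v‖ ≤ Λ₁ * ‖v‖)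
    (h0 : ∑ i, ∑ j, ‖(Ytᴴ * S * Yt - A) i j‖ ^ 2 ≤ E0 ^ 2)
    (h1 : ∑ i, ∑ j, ‖(A * X - X * diagonal (fun j => ((L j : ℝ) : 𝕜))) i j‖ ^ 2 ≤ E1 ^ 2)
    (hX : ∑ i, ∑ j, ‖(Xᴴ * X - 1) i j‖ ^ 2 ≤ ε ^ 2) :
    ∃ (lam : Fin (Fintype.card m) → ℝ) (w : Fin (Fintype.card m) → EuclideanSpace 𝕜 N),
      Antitone lam ∧ Orthonormal 𝕜 w ∧
      (∀ i, ∃ c : EuclideanSpace 𝕜 m, w i = toEuclideanLin Y c) ∧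
      (∀ i, toEuclideanLin S (w i) = (lam i : 𝕜) • w i) ∧
      ∀ i, |lam i - (isHermitian_diagonal_ofReal (𝕜 := 𝕜) L).eigenvalues₀ i| ≤
        ((E1 + E0 * √(1 + ε)) + ε * (nS + Lmax)) + 3 * (2 * Λ₁ * η + Λ * η ^ 2) := by
  have ha : 0 ≤ E1 + E0 * √(1 + ε) := by positivity
  have hGl : 0 ≤ 2 * Λ₁ * η + Λ * η ^ 2 := by positivity
  obtain ⟨hε, hr⟩ := div_sqrt_le_record_of_le_three_quarters ha hnS hLmax hε0 hGl hroute
  obtain ⟨lam, w, hmono, hon, hrange, heig, hrad⟩ :=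
    exists_orthonormal_eigenvectors_of_invariantBlock_float hS Y Yt hSY A X L hE0 hE1 hε0 (by linarith)
      (le_refl (0 : ℝ)) zero_lt_one hLmax.le hL hη hΛ hΛ₁ (sum_norm_sq_gram_sub_one_of_orthonormal Y hYY)
      hE hSop hSYop h0 h1 hX
  refine ⟨lam, w, hmono, hon, hrange, heig, fun i => (hrad i).trans ?_⟩
  have e : (E1 + √(1 + ε) * ((E0 + (2 * Λ₁ * η + Λ * η ^ 2)) + 0 * Lmax)) / ((1 - 0) * √(1 - ε)) =
      ((E1 + E0 * √(1 + ε)) + √(1 + ε) * (2 * Λ₁ * η + Λ * η ^ 2)) / √(1 - ε) := by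
    rw [zero_mul, add_zero, sub_zero, one_mul]
    ring
  rw [e]
  exact hr

/-- **Space-group radius of record, route B.** As
`exists_orthonormal_eigenvectors_of_invariantBlock_float_record_of_le_three_quarters`, but for blocks below
the pruning radius: `0 < D ≤ E0 ≤ nS`, `Lmax ≥ 0` and `δ_H ≤ (5/4)·D`; conclusion radius
`δ_H + (13/10)·(2Λ₁η + Λη²)`. [cite: StewartSun1990, Thm VI.1.15] -/
theorem exists_orthonormal_eigenvectors_of_invariantBlock_float_record_of_drop
    {S : Matrix N N 𝕜} (hS : S.IsHermitian) (Y Yt : Matrix N m 𝕜) {C : Matrix m m 𝕜}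
    (hSY : S * Y = Y * C) (hYY : Yᴴ * Y = 1) (A X : Matrix m m 𝕜) (L : m → ℝ)
    {E0 E1 ε nS Lmax η Λ Λ₁ D : ℝ} (hE1 : 0 ≤ E1) (hε0 : 0 ≤ ε) (hD : 0 < D) (hDE0 : D ≤ E0)
    (hE0nS : E0 ≤ nS) (hLmax : 0 ≤ Lmax) (hL : ∀ j, |L j| ≤ Lmax) (hη : 0 ≤ η) (hΛ : 0 ≤ Λ)
    (hΛ₁ : 0 ≤ Λ₁)
    (hroute : (E1 + E0 * √(1 + ε)) + ε * (nS + Lmax) ≤ 5 / 4 * D)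
    (hE : ∑ i, ∑ j, ‖(Yt - Y) i j‖ ^ 2 ≤ η ^ 2)
    (hSop : ∀ v : EuclideanSpace 𝕜 N, ‖toEuclideanLin S v‖ ≤ Λ * ‖v‖)
    (hSYop : ∀ v : EuclideanSpace 𝕜 m, ‖toEuclideanLin (S * Y) v‖ ≤ Λ₁ * ‖v‖)
    (h0 : ∑ i, ∑ j, ‖(Ytᴴ * S * Yt - A) i j‖ ^ 2 ≤ E0 ^ 2)
    (h1 : ∑ i, ∑ j, ‖(A * X - X * diagonal (fun j => ((L j : ℝ) : 𝕜))) i j‖ ^ 2 ≤ E1 ^ 2)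
    (hX : ∑ i, ∑ j, ‖(Xᴴ * X - 1) i j‖ ^ 2 ≤ ε ^ 2) :
    ∃ (lam : Fin (Fintype.card m) → ℝ) (w : Fin (Fintype.card m) → EuclideanSpace 𝕜 N),
      Antitone lam ∧ Orthonormal 𝕜 w ∧
      (∀ i, ∃ c : EuclideanSpace 𝕜 m, w i = toEuclideanLin Y c) ∧
      (∀ i, toEuclideanLin S (w i) = (lam i : 𝕜) • w i) ∧
      ∀ i, |lam i - (isHermitian_diagonal_ofReal (𝕜 := 𝕜) L).eigenvalues₀ i| ≤
        ((E1 + E0 * √(1 + ε)) + ε * (nS + Lmax)) + 13 / 10 * (2 * Λ₁ * η + Λ * η ^ 2) := by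
  have hE0 : 0 ≤ E0 := hD.le.trans hDE0
  have h1le : (1 : ℝ) ≤ √(1 + ε) := Real.one_le_sqrt.2 (by linarith)
  have hDa : D ≤ E1 + E0 * √(1 + ε) := by nlinarith [mul_le_mul_of_nonneg_left h1le hE0]
  have hGl : 0 ≤ 2 * Λ₁ * η + Λ * η ^ 2 := by positivity
  obtain ⟨hε, hr⟩ := div_sqrt_le_record_of_drop hD hDa (hDE0.trans hE0nS) hLmax hε0 hGl hroute
  obtain ⟨lam, w, hmono, hon, hrange, heig, hrad⟩ :=
    exists_orthonormal_eigenvectors_of_invariantBlock_float hS Y Yt hSY A X L hE0 hE1 hε0 (by linarith)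
      (le_refl (0 : ℝ)) zero_lt_one hLmax hL hη hΛ hΛ₁ (sum_norm_sq_gram_sub_one_of_orthonormal Y hYY)
      hE hSop hSYop h0 h1 hX
  refine ⟨lam, w, hmono, hon, hrange, heig, fun i => (hrad i).trans ?_⟩
  have e : (E1 + √(1 + ε) * ((E0 + (2 * Λ₁ * η + Λ * η ^ 2)) + 0 * Lmax)) / ((1 - 0) * √(1 - ε)) =
      ((E1 + E0 * √(1 + ε)) + √(1 + ε) * (2 * Λ₁ * η + Λ * η ^ 2)) / √(1 - ε) := by
    rw [zero_mul, add_zero, sub_zero, one_mul]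
    ring
  rw [e]
  exact hr

end EigenRadius

end Summit.Ventures.YMGap.FlowData
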